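import Mathlib
import HarnessLib
import Summits.ResolutionOfSingularities.ResolutionOfSingularities.Theorems.WildQuotientsWildQuotientResolutionS1aGameFrameWFFrom
import Summits.ResolutionOfSingularities.ResolutionOfSingularities.Theorems.WildQuotientsWildQuotientResolutionS1aKillFrame

/-!
# S1a — WINNING MODELS: the kill game in inductive form (a compositional interface for `stub_strategy`)

[OURS · L1 W4.5c · lead-1 g6] — NOT a statement of the manuscript; counted 0; AI-level work, weaker than expert
review. Crux stmt-ResolutionOfSingularities-17941 (`WildQuotients.CyclicQuotientFourfolds`), line `s1a-logminvertex` v5,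
stub `stub_strategy` (THE termination crux, `GameFrame.StrategyWFFrom p q G ρ g₀ (GModel.initial hq h₀)`).

`GameFrame.Wins M` — the least predicate containing the TERMINAL models and closed under «some admissible centre all of
whose moves win». It is the game-semantic content of a strategy, with the bookkeeping (measure `μ`, invariant `P`,
well-founded order `α`) removed:

* `wins_of_strategyWFFrom : StrategyWFFrom … M₀ → Wins M₀` (well-founded induction on `μ`);
* `killTameModel_of_wins : Wins M → KillTameModel q G ρ` given `MoveStep p` and `EndGluing` (structural induction —
  no measure needed), and `killTameModel_of_wins_prime` with both frame hypotheses discharged (`p` prime, `G = ⟨g₀⟩`);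
* `Wins.of_moves` — the COMPOSITION RULE a strategy is built from: an admissible centre at `M` and a winning
  continuation after each of its moves give `Wins M`.

So a proof of `stub_strategy` may be organised as a case analysis producing, at each non-terminal reachable model, ONE
admissible centre and a recursive call — the measure `μ̂` of STRATEGY-DESIGN v2 is then only the termination argument of
that recursion, not part of the statement.
-/

set_option linter.dupNamespace false

noncomputable section

open CategoryTheory AlgebraicGeometry TopologicalSpace
open Literature.AlgebraicGeometry.Resolution Literature.AlgebraicGeometry.RelativeSpec
open Summit.ResolutionOfSingularities.ResolutionOfSingularities.Theorems.WildQuotientResolution.S1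
open Summit.ResolutionOfSingularities.ResolutionOfSingularities.Theorems.WildQuotientResolution.S1.NodeAtlas
open Summit.ResolutionOfSingularities.ResolutionOfSingularities.Theorems.WildQuotientResolution.S1.MoveStep
open Summit.ResolutionOfSingularities.ResolutionOfSingularities.Theorems.WildQuotientResolution.S1.CentreNeBot
open Summit.ResolutionOfSingularities.ResolutionOfSingularities.Theorems.WildQuotientResolution.S1.BlowupCharts

namespace Summit.ResolutionOfSingularities.ResolutionOfSingularities.Theorems.WildQuotientResolution.S1.GameFrame

variable (p : ℕ) {X' X₁ : Scheme.{0}} (q : X' ⟶ X₁) (G : Type) [Group G] (ρ : G →* Aut X') (g₀ : G)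

/-- **WINNING models** of the kill game: terminal models win; a model with an admissible centre all of whose moves
win, wins. [OURS · L1 W4.5c] — NOT a statement of the manuscript. -/
inductive Wins : GModel p q G ρ g₀ → Prop
  /-- a terminal model wins -/
  | terminal (M : GModel p q G ρ g₀) : M.Terminal → Wins M
  /-- a model with an admissible centre all of whose moves win, wins -/
  | move (M : GModel p q G ρ g₀) (𝒦 : ReesFiltration M.V) (d : ℕ) :
      IsAdmissibleCentre p M.act g₀ 𝒦 d → (∀ M' : GModel p q G ρ g₀, M.IsMoveOf M' 𝒦 d → Wins M') → Wins M

variable {p q G ρ g₀}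

/-- **The composition rule**: an admissible centre at `M` and winning continuations after each move. -/
theorem Wins.of_moves {M : GModel p q G ρ g₀} (𝒦 : ReesFiltration M.V) (d : ℕ)
    (h𝒦 : IsAdmissibleCentre p M.act g₀ 𝒦 d) (h : ∀ M' : GModel p q G ρ g₀, M.IsMoveOf M' 𝒦 d → Wins p q G ρ g₀ M') :
    Wins p q G ρ g₀ M :=
  Wins.move M 𝒦 d h𝒦 h

/-- **A (relative, well-founded) strategy from `M₀` makes `M₀` win** — well-founded induction on the measure over the
models satisfying the invariant. -/
theorem wins_of_strategyWFFrom {M₀ : GModel p q G ρ g₀} (h : StrategyWFFrom p q G ρ g₀ M₀) : Wins p q G ρ g₀ M₀ := by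
  obtain ⟨α, _, hwf, μ, P, hP₀, hμ⟩ := h
  suffices H : ∀ a : α, ∀ M : GModel p q G ρ g₀, P M → μ M = a → Wins p q G ρ g₀ M from H (μ M₀) M₀ hP₀ rfl
  intro a
  induction a using hwf.induction with
  | _ a ih =>
    intro M hPM ha
    by_cases hT : M.Terminal
    · exact Wins.terminal M hT
    · obtain ⟨𝒦, d, h𝒦, hdec⟩ := hμ M hPM hT
      exact Wins.move M 𝒦 d h𝒦 fun M' hM' => ih (μ M') (ha ▸ (hdec M' hM').2) M' (hdec M' hM').1 rfl

/-- An absolute well-founded strategy makes every model win. -/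
theorem wins_of_strategyWF (h : StrategyWF p q G ρ g₀) (M₀ : GModel p q G ρ g₀) : Wins p q G ρ g₀ M₀ :=
  wins_of_strategyWFFrom (strategyWFFrom_of_strategyWF h M₀)

/-- **A winning model yields `KillTameModel`** (given the MOVE and the END GLUING) — structural induction on `Wins`:
terminal ⇒ `killTameModel_of_terminal`; otherwise realise ONE move of the winning centre (`exists_isMoveOf`) and
recurse. -/
theorem killTameModel_of_wins [Finite G] [X₁.IsSeparated] [IsSeparated q] (hG : ∀ g : G, g ∈ Subgroup.zpowers g₀)
    (hmove : MoveStep.{0} p) (hend : EndGluing) {M : GModel p q G ρ g₀} (h : Wins p q G ρ g₀ M) :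
    KillTameModel q G ρ := by
  induction h with
  | terminal M hT => exact killTameModel_of_terminal hend M hT
  | move M 𝒦 d h𝒦 _ ih =>
    obtain ⟨M', hM'⟩ := exists_isMoveOf hmove hG M h𝒦
    exact ih M' hM'

/-- **… with the frame discharged**: for `p` prime and `G = ⟨g₀⟩`, a winning model yields `KillTameModel`
(`blowupNodeAtlas_of_prime`, `moveStep_of_blowupNodeAtlas`, `endGluing`). -/
theorem killTameModel_of_wins_prime [Finite G] [X₁.IsSeparated] [IsSeparated q] (hp : p.Prime)
    (hG : ∀ g : G, g ∈ Subgroup.zpowers g₀) {M : GModel p q G ρ g₀} (h : Wins p q G ρ g₀ M) : KillTameModel q G ρ :=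
  killTameModel_of_wins hG (moveStep_of_blowupNodeAtlas (blowupNodeAtlas_of_prime hp)) endGluing h

/-- **… from the initial model**: a node atlas on `X′` and a win of the initial model give `KillTameModel`. -/
theorem killTameModel_of_wins_initial [Finite G] [X₁.IsSeparated] [IsSeparated q] [IsIntegral X']
    [IsLocallyNoetherian X'] (hp : p.Prime) (hG : ∀ g : G, g ∈ Subgroup.zpowers g₀)
    (hq : ∀ g : G, (ρ g).hom ≫ q = q) (hatlas : NodeAtlas p (⟨ρ, hq⟩ : ActionOver q G) g₀)
    (h : Wins p q G ρ g₀ (GModel.initial hq hatlas)) : KillTameModel q G ρ :=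
  killTameModel_of_wins_prime hp hG h

end Summit.ResolutionOfSingularities.ResolutionOfSingularities.Theorems.WildQuotientResolution.S1.GameFrame

end
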